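/-
Copyright (c) 2026. All rights reserved.
Released under Apache 2.0 license as described in the file LICENSE.
Authors: abc-iut cell — seat abc-iut-w6-d031 (gen 2; block C / W6, sequel of row «COR27cf-GENUINE-GROUPLAW»).
-/
import Literature.AnabelianGeometry.AbsoluteAnabelian.HolomorphicEllipticCuspidalizationGenuineGroupLaw
import Literature.AnabelianGeometry.AbsoluteAnabelian.HolomorphicEllipticCuspidalizationGenuineCurve
import HarnessLib

/-!
# [AbsTopIII] Cor 2.7 (c) at the GENUINE punctured elliptic curve: THE group law (existence AND uniqueness)

S. Mochizuki, *Topics in absolute anabelian geometry III*, §2, Corollary 2.7 (c), kurims p. 59 (J. Math. Sci.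
Univ. Tokyo **22** (2015) p. 1016; bib key `MochizukiAbsTopIII2015`): «one may construct the group structure
on (the one-point compactification of) `E^top` (that arises from the elliptic curve determined by `E`) as
the unique topological group structure that extends the group structure on the torsion points of (b)».

PROOF-ONLY junction (no definition, no named fact): abc-iut-L4-t8's EXISTENCE
(`exists_groupLaw_of_isPuncturedEllipticCurve`, p437372: for every punctured elliptic curve `E` in the typed
sense a commutative topological group law on `OnePoint E` with `∞ = 0`, isomorphic as a topological group
and holomorphically on `E` to a complex torus `ℂ/Φ(ℤ²)` of the tree) and this seat's UNIQUENESS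
(`addCommGroup_eq_of_torusModels`, p439414: two such laws coincide) give ONE theorem:

* `existsUnique_groupLaw_of_isPuncturedEllipticCurve` — for every typed punctured elliptic curve `E` there
  is EXACTLY ONE commutative group structure on `OnePoint E` which is a topological group law with neutral
  element the cusp `∞` and along which `OnePoint E` is a complex torus of the tree (topological-group
  isomorphism `ψ : OnePoint E ≃ₜ+ ComplexTorus Φ`, holomorphic on `E`) — «THE group structure on (the
  one-point compactification of) `E^top` (that arises from the elliptic curve determined by `E`)».

By p437372 this law also satisfies: cuspidal torsion points = points of finite order, and for every
`N ≠ 0` some elliptic cuspidalization diagram has Galois group `≅` the `N`-torsion (the Gal-induced group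
structure of (b)); by p439414 / p438511 it is functorial under every finite étale holomorphic map of typed
once-punctured elliptic curves.  HONEST FRAMING: OUR proofs about OUR typing of a refereed pre-IUT
statement; typed ≠ endorsed; nothing here bears on the disputed [IUTchIII] Cor. 3.12; no side taken.
-/

noncomputable section

namespace Literature.AnabelianGeometry.AbsoluteAnabelian

namespace HolomorphicEllipticCuspidalization

open _root_.TopologicalSpace _root_.Topology _root_.OnePoint
open scoped _root_.Manifold _root_.ContDiff
open Literature.Geometry.Kaehler (ComplexTorus)

variable {E : Type} [TopologicalSpace E] [T2Space E] [ChartedSpace ℂ E] [IsManifold 𝓘(ℂ, ℂ) ω E]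

/-- **[AbsTopIII] Cor 2.7 (c): THE group law of a punctured elliptic curve, at the GENUINE object** — for
every punctured elliptic curve `E` in the typed sense (`IsPuncturedEllipticCurve`) there is a UNIQUE
commutative group structure on the one-point compactification `OnePoint E` that is a topological group law
with `∞ = 0` along which `OnePoint E` is, as a topological group and holomorphically on `E`, a complex torus
`ℂ/Φ(ℤ²)` of the tree (existence: abc-iut-L4-t8's `exists_groupLaw_of_isPuncturedEllipticCurve`; uniqueness:
`addCommGroup_eq_of_torusModels`). [cite: MochizukiAbsTopIII2015, Corollary 2.7 (c) p.59] -/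
theorem existsUnique_groupLaw_of_isPuncturedEllipticCurve
    (hE : TorsionPointsDenseUniqueGroupLaw.IsPuncturedEllipticCurve E) :
    ∃! g : AddCommGroup (OnePoint E),
      letI : AddCommGroup (OnePoint E) := g
      IsTopologicalAddGroup (OnePoint E) ∧ (∞ : OnePoint E) = 0 ∧
      ∃ (Φ : (Fin 2 → ℝ) ≃L[ℝ] ℂ) (ψ : OnePoint E ≃ₜ+ ComplexTorus Φ),
        MDifferentiable 𝓘(ℂ, ℂ) 𝓘(ℂ, ℂ) (fun x : E => ψ x) := by
  obtain ⟨g, htop, h0, hψ, -, -⟩ := exists_groupLaw_of_isPuncturedEllipticCurve hE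
  refine ⟨g, ⟨htop, h0, hψ⟩, fun g' hg' => ?_⟩
  obtain ⟨htop', h0', Φ', ψ', hψ'⟩ := hg'
  obtain ⟨Φ, ψ, hψ⟩ := hψ
  exact addCommGroup_eq_of_torusModels g' g htop' htop h0' h0 ψ' hψ' ψ hψ

end HolomorphicEllipticCuspidalization

end Literature.AnabelianGeometry.AbsoluteAnabelian

end
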